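import Mathlib.NumberTheory.LSeries.Dirichlet
import Mathlib.NumberTheory.LSeries.DirichletContinuation
import Mathlib.NumberTheory.LSeries.Deriv
import Mathlib.NumberTheory.Chebyshev
import Mathlib.Analysis.SpecialFunctions.Pow.Real
import Mathlib.Analysis.Complex.ExponentialBounds
import Literature.NumberTheory.LFunctions.PrimeRpowTailChebyshev
import Literature.NumberTheory.LFunctions.MertensTail
import Literature.NumberTheory.Sieve.SiftedLargeSieveCharacters
import HarnessLib

/-!
# The Dirichlet-series side of Bombieri's Lemme B: derivatives of `L'/L` as weighted prime sums,
# the weights `p_k(u) = e^{-u} u^k / k!`, and the tails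

Topic `Literature/NumberTheory/LFunctions`, sub-namespace `LogFreeDensity`. Everything here is
PROVED. These are the elementary inputs of LEMME B in Bombieri, *Le grand crible* (Astérisque 18),
§6, pp. 46–48:

* `iteratedDeriv_logDeriv_LFunction_eq` — for `Re s > 1`,
  `(L'/L)^{(k)}(s, χ) = (−1)^{k+1} ∑_n Λ(n) χ(n) (log n)^k n^{-s}` ("On a, pour `σ > 1`:
  `(d/ds)^k (L'/L)(s, χ) = (−1)^{k+1} ∑ Λ(n)(log n)^k χ(n) n^{-s}`", p. 46);
* `pk` — Bombieri's weights `p_k(u) = e^{-u} u^k/k!` with `(log n)^k n^{-r}/k! = r^{-k} p_k(r log n)`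
  (`pow_log_mul_rpow_neg_eq`), the bounds `0 ≤ p_k ≤ 1`, `p_k(u) ≤ (eu/k)^k e^{-u}`, hence
  `p_k(u) ≤ (e/θ)^k` for `u ≤ k/θ` and `p_k(u) ≤ e^{-19u/20}` for `u ≥ 120 k` ("Il est facile de voir
  que `p_k(u) ≤ …` si `u ≤ 10⁻⁵k`, `p_k(u) ≤ … e^{-u/2}` si `u ≥ 20k`", p. 46), and the derivative
  `p_k' = p_{k-1} − p_k`, `|p_k'| ≤ 1` (p. 48: "`p_k'(u) = p_{k-1}(u) − p_k(u)`, donc `|p_k'(u)| ≤ 1`");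
* `sum_vonMangoldt_div_le` — `∑_{n ≤ N} Λ(n)/n ≤ log N + log 4 + 4` (from
  `∑_{n ≤ N} Λ(n)⌊N/n⌋ = log N!` and Chebyshev's `ψ(N) ≤ (log 4 + 4)N`, Mathlib).

## References
* [Bombieri1987GrandCrible] §6 Lemme B, pp. 46–48.
-/

noncomputable section

open Complex Finset Filter Real
open scoped LSeries.notation ArithmeticFunction.vonMangoldt Topology Nat

namespace Literature.NumberTheory.LFunctions.LogFreeDensity

/-! ### `(L'/L)^{(k)}` as a Dirichlet series -/

/-- For `Re s > 1`: `L'/L(·, χ)` agrees near `s` with `−L(χΛ, ·)`. [folklore] -/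
theorem logDeriv_LFunction_eventuallyEq {N : ℕ} [NeZero N] (χ : DirichletCharacter ℂ N) {s : ℂ}
    (hs : 1 < s.re) :
    logDeriv χ.LFunction =ᶠ[𝓝 s] fun z => -LSeries (↗χ * ↗Λ) z := by
  have hopen : IsOpen {z : ℂ | 1 < z.re} := isOpen_lt continuous_const Complex.continuous_re
  filter_upwards [hopen.mem_nhds hs] with z hz
  rw [DirichletCharacter.LSeries_twist_vonMangoldt_eq χ hz, neg_div, neg_neg, logDeriv_apply,
    DirichletCharacter.deriv_LFunction_eq_deriv_LSeries χ hz, DirichletCharacter.LFunction_eq_LSeries χ hz]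

/-- The abscissa of absolute convergence of `χΛ` is at most `1`. [folklore] -/
theorem abscissaOfAbsConv_twist_vonMangoldt_le {N : ℕ} (χ : DirichletCharacter ℂ N) :
    LSeries.abscissaOfAbsConv (↗χ * ↗Λ) ≤ 1 :=
  LSeries.abscissaOfAbsConv_le_of_forall_lt_LSeriesSummable fun y hy =>
    DirichletCharacter.LSeriesSummable_twist_vonMangoldt χ (by simpa using hy)

/-- **`(L'/L)^{(k)}(s, χ) = (−1)^{k+1} ∑_n Λ(n)χ(n)(log n)^k n^{-s}`** for `Re s > 1`
(Bombieri p. 46), in Mathlib's `LSeries` language: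
`iteratedDeriv k (L'/L) s = (−1)^{k+1} L(log^k · χΛ, s)`. [cite: Bombieri1987GrandCrible, §6 Lemme B (proof)] -/
theorem iteratedDeriv_logDeriv_LFunction_eq {N : ℕ} [NeZero N] (χ : DirichletCharacter ℂ N) {s : ℂ}
    (hs : 1 < s.re) (k : ℕ) :
    iteratedDeriv k (logDeriv χ.LFunction) s =
      (-1) ^ (k + 1) * LSeries (LSeries.logMul^[k] (↗χ * ↗Λ)) s := by
  rw [(logDeriv_LFunction_eventuallyEq χ hs).iteratedDeriv_eq, iteratedDeriv_fun_neg,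
    LSeries_iteratedDeriv k (lt_of_le_of_lt (abscissaOfAbsConv_twist_vonMangoldt_le χ) (by exact_mod_cast hs))]
  ring

/-- The coefficients `log^k · χΛ` explicitly: `(log n)^k χ(n) Λ(n)`. [folklore] -/
theorem logMul_iterate_apply (f : ℕ → ℂ) (k n : ℕ) :
    (LSeries.logMul^[k] f) n = (Real.log n : ℂ) ^ k * f n := by
  induction k with
  | zero => simp
  | succ k ih => rw [Function.iterate_succ_apply', LSeries.logMul, ih, pow_succ, ← Complex.natCast_log]; ring

/-- **The norm of `(L'/L)^{(k)}(s, χ)` is that of the prime-power sum**: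
`‖(L'/L)^{(k)}(s, χ)‖ = ‖∑' n, (log n)^k χ(n)Λ(n) n^{-s}‖` (`Re s > 1`). [folklore] -/
theorem norm_iteratedDeriv_logDeriv_LFunction_eq {N : ℕ} [NeZero N] (χ : DirichletCharacter ℂ N)
    {s : ℂ} (hs : 1 < s.re) (k : ℕ) :
    ‖iteratedDeriv k (logDeriv χ.LFunction) s‖ =
      ‖∑' n : ℕ, LSeries.term (fun n => (Real.log n : ℂ) ^ k * (χ n * Λ n)) s n‖ := by
  rw [iteratedDeriv_logDeriv_LFunction_eq χ hs k, norm_mul, norm_pow, norm_neg, norm_one, one_pow,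
    one_mul, LSeries]
  congr 1
  refine tsum_congr fun n => ?_
  simp only [LSeries.term_def, logMul_iterate_apply, Pi.mul_apply]

/-! ### The weights `p_k(u) = e^{-u} u^k / k!` -/

/-- Bombieri's weight `p_k(u) = e^{-u} u^k / k!` (p. 46). [cite: Bombieri1987GrandCrible, §6 Lemme B (proof)] -/
def pk (k : ℕ) (u : ℝ) : ℝ := Real.exp (-u) * u ^ k / k.factorial

/-- `p_k(u) ≥ 0` for `u ≥ 0`. [folklore] -/
theorem pk_nonneg (k : ℕ) {u : ℝ} (hu : 0 ≤ u) : 0 ≤ pk k u := by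
  unfold pk; positivity

/-- `(log n)^k n^{-r} / k! = r^{-k} p_k(r log n)` (`n ≥ 1`, `r > 0`). [folklore] -/
theorem pow_log_mul_rpow_neg_eq {r : ℝ} (hr : 0 < r) (k : ℕ) {y : ℝ} (hy : 0 < y) :
    Real.log y ^ k * y ^ (-r) / k.factorial = r⁻¹ ^ k * pk k (r * Real.log y) := by
  unfold pk
  rw [Real.rpow_def_of_pos hy, mul_pow, inv_pow]
  have : Real.log y * -r = -(r * Real.log y) := by ring
  rw [this]
  field_simp

/-- `p_k(u) ≤ 1` for `u ≥ 0` (`u^k/k! ≤ e^u`). [folklore] -/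
theorem pk_le_one (k : ℕ) {u : ℝ} (hu : 0 ≤ u) : pk k u ≤ 1 := by
  unfold pk
  have h := Real.pow_div_factorial_le_exp (x := u) hu k
  rw [mul_div_assoc]
  calc Real.exp (-u) * (u ^ k / k.factorial) ≤ Real.exp (-u) * Real.exp u :=
        mul_le_mul_of_nonneg_left h (Real.exp_pos _).le
    _ = 1 := by rw [← Real.exp_add]; simp

/-- `p_k(u) ≤ (e u / k)^k e^{-u}` (`k ≥ 1`), from `k! ≥ (k/e)^k`. [folklore] -/
theorem pk_le_pow_mul_exp {k : ℕ} (hk : 1 ≤ k) {u : ℝ} (hu : 0 ≤ u) :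
    pk k u ≤ (Real.exp 1 * u / k) ^ k * Real.exp (-u) := by
  unfold pk
  have hk0 : (0 : ℝ) < k := by exact_mod_cast hk
  -- `(k/e)^k ≤ k!`, i.e. `k^k ≤ e^k k!`
  have hfac : ((k : ℝ) / Real.exp 1) ^ k ≤ k.factorial := by
    rw [div_pow, div_le_iff₀ (by positivity)]
    have h := Real.pow_div_factorial_le_exp (x := (k : ℝ)) hk0.le k
    rw [div_le_iff₀ (by positivity)] at h
    calc (k : ℝ) ^ k ≤ Real.exp k * k.factorial := h
      _ = k.factorial * Real.exp 1 ^ k := by rw [← Real.exp_one_pow]; ring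
  have hfacpos : (0 : ℝ) < k.factorial := by positivity
  rw [div_le_iff₀ hfacpos]
  calc Real.exp (-u) * u ^ k = ((Real.exp 1 * u / k) ^ k * Real.exp (-u)) * ((k : ℝ) / Real.exp 1) ^ k := by
        rw [div_pow, div_pow, mul_pow]
        field_simp
    _ ≤ ((Real.exp 1 * u / k) ^ k * Real.exp (-u)) * k.factorial :=
        mul_le_mul_of_nonneg_left hfac (by positivity)

/-- **Small `u`:** `p_k(u) ≤ (e/θ)^k` for `0 ≤ u ≤ k/θ` (`θ > 0`). [cite: Bombieri1987GrandCrible, §6 Lemme B (proof)] -/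
theorem pk_le_of_le_div {k : ℕ} (hk : 1 ≤ k) {u θ : ℝ} (hθ : 0 < θ) (hu : 0 ≤ u) (huk : u ≤ k / θ) :
    pk k u ≤ (Real.exp 1 / θ) ^ k := by
  have hk0 : (0 : ℝ) < k := by exact_mod_cast hk
  refine (pk_le_pow_mul_exp hk hu).trans ?_
  have h1 : Real.exp 1 * u / k ≤ Real.exp 1 / θ := by
    rw [div_le_div_iff₀ hk0 hθ]
    have := mul_le_mul_of_nonneg_left huk (Real.exp_pos 1).le
    calc Real.exp 1 * u * θ ≤ Real.exp 1 * (k / θ) * θ := by nlinarith [Real.exp_pos 1]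
      _ = Real.exp 1 * k := by field_simp
  calc (Real.exp 1 * u / k) ^ k * Real.exp (-u) ≤ (Real.exp 1 / θ) ^ k * 1 := by
        refine mul_le_mul (pow_le_pow_left₀ (by positivity) h1 k) ?_ (Real.exp_pos _).le (by positivity)
        rw [Real.exp_le_one_iff]; linarith
    _ = _ := mul_one _

/-- `log(120 e) ≤ 6 = 120/20`: the numerical input of the large-`u` bound. [folklore] -/
theorem log_mul_exp_one_le : Real.log (120 * Real.exp 1) ≤ 6 := by
  rw [Real.log_mul (by norm_num) (Real.exp_pos 1).ne', Real.log_exp]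
  have h : Real.log 120 ≤ 5 := by
    rw [Real.log_le_iff_le_exp (by norm_num)]
    have h1 : (2.7 : ℝ) ≤ Real.exp 1 := by have := Real.exp_one_gt_d9; linarith
    have h5 : Real.exp 5 = Real.exp 1 ^ 5 := by rw [← Real.exp_nat_mul]; norm_num
    rw [h5]
    have := pow_le_pow_left₀ (by norm_num : (0:ℝ) ≤ 2.7) h1 5
    have h27 : (120 : ℝ) ≤ (2.7 : ℝ) ^ 5 := by norm_num
    exact h27.trans this
  linarith

/-- **Large `u`:** `p_k(u) ≤ e^{-19u/20}` for `u ≥ 120 k`, `k ≥ 1`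
(`(eu/k)^k = e^{k log(eu/k)} ≤ e^{u/20}` since `log(et) ≤ t/20` for `t ≥ 120`). [cite: Bombieri1987GrandCrible, §6 Lemme B (proof)] -/
theorem pk_le_exp_of_ge {k : ℕ} (hk : 1 ≤ k) {u : ℝ} (hu : 120 * k ≤ u) :
    pk k u ≤ Real.exp (-(19 / 20 * u)) := by
  have hk0 : (0 : ℝ) < k := by exact_mod_cast hk
  have hu0 : 0 < u := by nlinarith
  refine (pk_le_pow_mul_exp hk hu0.le).trans ?_
  -- `(eu/k)^k ≤ e^{u/20}`
  set t : ℝ := u / k with ht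
  have ht120 : 120 ≤ t := by rw [ht, le_div_iff₀ hk0]; linarith
  have hlog : Real.log (Real.exp 1 * t) ≤ t / 20 := by
    -- `log(e t) = log(120 e) + log(t/120) ≤ 6 + (t/120 - 1) ≤ t/20`
    have ht0 : 0 < t := by linarith
    have h1 : Real.log (Real.exp 1 * t) = Real.log (120 * Real.exp 1) + Real.log (t / 120) := by
      rw [← Real.log_mul (by positivity) (by positivity)]; congr 1; field_simp
    have h2 : Real.log (t / 120) ≤ t / 120 - 1 := by
      have := Real.log_le_sub_one_of_pos (show 0 < t / 120 by positivity); linarith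
    linarith [log_mul_exp_one_le]
  have hpow : (Real.exp 1 * u / k) ^ k ≤ Real.exp (u / 20) := by
    have heq : Real.exp 1 * u / k = Real.exp 1 * t := by rw [ht]; ring
    rw [heq, ← Real.exp_log (show 0 < Real.exp 1 * t by positivity), ← Real.exp_nat_mul]
    refine Real.exp_le_exp.2 ?_
    calc (k : ℝ) * Real.log (Real.exp 1 * t) ≤ k * (t / 20) := mul_le_mul_of_nonneg_left hlog hk0.le
      _ = u / 20 := by rw [ht]; field_simp
  calc (Real.exp 1 * u / k) ^ k * Real.exp (-u) ≤ Real.exp (u / 20) * Real.exp (-u) :=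
        mul_le_mul_of_nonneg_right hpow (Real.exp_pos _).le
    _ = Real.exp (-(19 / 20 * u)) := by rw [← Real.exp_add]; ring_nf

/-- The derivative: `p_k' = p_{k-1} − p_k` (`k ≥ 1`). [cite: Bombieri1987GrandCrible, §6 Lemme B (proof)] -/
theorem hasDerivAt_pk {k : ℕ} (hk : 1 ≤ k) (u : ℝ) :
    HasDerivAt (pk k) (pk (k - 1) u - pk k u) u := by
  have h1 : HasDerivAt (fun u => Real.exp (-u)) (-Real.exp (-u)) u := by
    simpa using ((hasDerivAt_id u).neg.exp)
  have h2 : HasDerivAt (fun u : ℝ => u ^ k) ((k : ℝ) * u ^ (k - 1)) u := by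
    simpa using (hasDerivAt_pow k u)
  have h := (h1.mul h2).div_const (k.factorial : ℝ)
  have hfun : pk k = fun x => Real.exp (-x) * x ^ k / (k.factorial : ℝ) := by
    funext x; rfl
  rw [hfun]
  refine h.congr_deriv ?_
  have hfac : (k.factorial : ℝ) = k * ((k - 1).factorial : ℝ) := by
    rw [← Nat.mul_factorial_pred (by omega : k ≠ 0)]; push_cast; ring
  have hk0 : (k : ℝ) ≠ 0 := by exact_mod_cast (show k ≠ 0 by omega)
  have hf0 : ((k - 1).factorial : ℝ) ≠ 0 := by positivity
  unfold pk
  rw [hfac]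
  field_simp
  ring

/-- `|p_k'(u)| ≤ 1` for `u ≥ 0`, `k ≥ 1`. [cite: Bombieri1987GrandCrible, §6 Lemme B (proof)] -/
theorem abs_deriv_pk_le {k : ℕ} (hk : 1 ≤ k) {u : ℝ} (hu : 0 ≤ u) : |deriv (pk k) u| ≤ 1 := by
  rw [(hasDerivAt_pk hk u).deriv]
  have h0 := pk_nonneg k hu
  have h1 := pk_le_one k hu
  have h2 := pk_nonneg (k - 1) hu
  have h3 := pk_le_one (k - 1) hu
  rw [abs_le]; constructor <;> linarith

/-! ### The tails: sums of `Λ(n)/n` -/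

/-- `∑_{k=2}^{K} p^{-k} ≤ 1/(p(p-1))` (`p ≥ 2`). [folklore] -/
theorem sum_Icc_two_inv_pow_le {p : ℕ} (hp : 2 ≤ p) (K : ℕ) :
    ∑ k ∈ Icc 2 K, ((p : ℝ) ^ k)⁻¹ ≤ ((p : ℝ) * ((p : ℝ) - 1))⁻¹ := by
  have hp0 : (0 : ℝ) < p := by positivity
  have hp1 : (0 : ℝ) < (p : ℝ) - 1 := by
    have : (2 : ℝ) ≤ p := by exact_mod_cast hp
    linarith
  -- shift: `∑_{k=2}^{K} p^{-k} = p^{-1} ∑_{j=1}^{K-1} p^{-j}`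
  have hshift : ∑ k ∈ Icc 2 K, ((p : ℝ) ^ k)⁻¹ = (p : ℝ)⁻¹ * ∑ j ∈ Icc 1 (K - 1), ((p : ℝ) ^ j)⁻¹ := by
    rcases Nat.lt_or_ge K 2 with hK | hK
    · rw [Finset.Icc_eq_empty_of_lt hK, sum_empty]
      have : K - 1 < 1 := by omega
      rw [Finset.Icc_eq_empty_of_lt this, sum_empty, mul_zero]
    · rw [mul_sum]
      refine (Finset.sum_nbij' (fun k => k - 1) (fun j => j + 1) ?_ ?_ ?_ ?_ ?_)
      · intro k hk; rw [mem_Icc] at hk ⊢; omega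
      · intro j hj; rw [mem_Icc] at hj ⊢; omega
      · intro k hk; rw [mem_Icc] at hk; omega
      · intro j _; omega
      · intro k hk
        rw [mem_Icc] at hk
        have : k = (k - 1) + 1 := by omega
        conv_lhs => rw [this, pow_succ]
        rw [mul_inv, mul_comm]
  rw [hshift]
  have h := Literature.NumberTheory.Sieve.LargeSieve.sum_Icc_inv_pow_le hp (K - 1)
  calc (p : ℝ)⁻¹ * ∑ j ∈ Icc 1 (K - 1), ((p : ℝ) ^ j)⁻¹ ≤ (p : ℝ)⁻¹ * ((p : ℝ) - 1)⁻¹ :=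
        mul_le_mul_of_nonneg_left h (by positivity)
    _ = ((p : ℝ) * ((p : ℝ) - 1))⁻¹ := by rw [mul_inv]

/-- **The prime powers with exponent `≥ 2` contribute `≤ 2`:**
`∑_{n ≤ N, n not prime} Λ(n)/n ≤ ∑_p log p/(p(p-1)) ≤ 2`. [folklore] -/
theorem sum_vonMangoldt_div_not_prime_le (N : ℕ) :
    ∑ n ∈ (Icc 1 N).filter (fun n => ¬ n.Prime), Λ n / n ≤ 2 := by
  classical
  rcases Nat.eq_zero_or_pos N with rfl | hNpos
  · simp
  set f : ℕ → ℝ := fun n => if n.Prime then 0 else Λ n / n with hf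
  have hf0 : ∀ n, 0 ≤ f n := fun n => by
    rw [hf]; dsimp only; split_ifs
    · exact le_rfl
    · exact div_nonneg ArithmeticFunction.vonMangoldt_nonneg (Nat.cast_nonneg n)
  have hN0 : (0 : ℝ) ≤ N := Nat.cast_nonneg N
  -- the target is `∑_{prime powers ≤ N} f`
  have hstep1 : ∑ n ∈ (Icc 1 N).filter (fun n => ¬ n.Prime), Λ n / n =
      ∑ n ∈ (Ioc 0 ⌊(N : ℝ)⌋₊).filter IsPrimePow, f n := by
    rw [Nat.floor_natCast, show Ioc 0 N = Icc 1 N from rfl, sum_filter, sum_filter]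
    refine sum_congr rfl fun n _ => ?_
    by_cases hpr : n.Prime
    · rw [if_neg (not_not.2 hpr), if_pos hpr.isPrimePow, hf]; dsimp only; rw [if_pos hpr]
    · rw [if_pos hpr, hf]; dsimp only
      by_cases hpp : IsPrimePow n
      · rw [if_pos hpp, if_neg hpr]
      · rw [if_neg hpp, ArithmeticFunction.vonMangoldt_eq_zero_iff.2 hpp, zero_div]
  rw [hstep1, Chebyshev.sum_PrimePow_eq_sum_sum f hN0]
  set K := ⌊Real.log N / Real.log 2⌋₊ with hK
  -- each inner sum is at most `∑_{p ≤ N} g k p` with `g 1 p = 0`, `g k p = log p / p^k`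
  set g : ℕ → ℕ → ℝ := fun k p => if k = 1 then 0 else Real.log p * ((p : ℝ) ^ k)⁻¹ with hg
  have hg0 : ∀ k p, 0 ≤ g k p := fun k p => by
    rw [hg]; dsimp only; split_ifs
    · exact le_rfl
    · exact mul_nonneg (Real.log_natCast_nonneg p) (by positivity)
  have hinner : ∀ k ∈ Icc 1 K,
      ∑ p ∈ (Ioc 0 ⌊(N : ℝ) ^ ((1 : ℝ) / k)⌋₊).filter Nat.Prime, f (p ^ k) ≤
        ∑ p ∈ Nat.primesLE N, g k p := by
    intro k hk
    rw [mem_Icc] at hk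
    have hsub : (Ioc 0 ⌊(N : ℝ) ^ ((1 : ℝ) / k)⌋₊).filter Nat.Prime ⊆ Nat.primesLE N := by
      intro p hp
      rw [mem_filter, mem_Ioc] at hp
      rw [Nat.mem_primesLE]
      refine ⟨?_, hp.2⟩
      refine hp.1.2.trans (Nat.floor_le_of_le ?_)
      have hN1 : (1 : ℝ) ≤ N := by exact_mod_cast hNpos
      calc (N : ℝ) ^ ((1 : ℝ) / k) ≤ (N : ℝ) ^ (1 : ℝ) := by
            refine Real.rpow_le_rpow_of_exponent_le hN1 ?_
            rw [div_le_one (by exact_mod_cast hk.1)]; exact_mod_cast hk.1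
        _ = N := Real.rpow_one _
    have hval : ∀ p ∈ (Ioc 0 ⌊(N : ℝ) ^ ((1 : ℝ) / k)⌋₊).filter Nat.Prime, f (p ^ k) = g k p := by
      intro p hp
      rw [mem_filter] at hp
      have hpr := hp.2
      rw [hf, hg]; dsimp only
      by_cases hk1 : k = 1
      · subst hk1; rw [pow_one, if_pos hpr, if_pos rfl]
      · have hk2 : 2 ≤ k := by omega
        rw [if_neg (Nat.Prime.not_prime_pow hk2), if_neg hk1,
          ArithmeticFunction.vonMangoldt_apply_pow (by omega),
          ArithmeticFunction.vonMangoldt_apply_prime hpr, Nat.cast_pow, div_eq_mul_inv]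
    rw [sum_congr rfl hval]
    exact sum_le_sum_of_subset_of_nonneg hsub fun p _ _ => hg0 k p
  refine (sum_le_sum hinner).trans ?_
  -- swap and bound the geometric inner sums
  rw [sum_comm]
  have hgeom : ∀ p ∈ Nat.primesLE N, ∑ k ∈ Icc 1 K, g k p ≤ Real.log p / (p * (p - 1)) := by
    intro p hp
    rw [Nat.mem_primesLE] at hp
    have hp2 := hp.2.two_le
    have hsplit : ∑ k ∈ Icc 1 K, g k p = ∑ k ∈ Icc 2 K, Real.log p * ((p : ℝ) ^ k)⁻¹ := by
      rcases Nat.eq_zero_or_pos K with hK0 | hKpos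
      · rw [hK0]; simp
      · rw [← Finset.insert_Icc_succ_left_eq_Icc hKpos, sum_insert (by simp)]
        rw [hg]; dsimp only
        rw [if_pos rfl, zero_add]
        refine sum_congr rfl fun k hk => ?_
        rw [mem_Icc] at hk
        rw [if_neg (by omega)]
    rw [hsplit, ← mul_sum, div_eq_mul_inv]
    exact mul_le_mul_of_nonneg_left (sum_Icc_two_inv_pow_le hp2 K) (Real.log_natCast_nonneg p)
  refine (sum_le_sum hgeom).trans ?_
  exact Literature.NumberTheory.LFunctions.MertensBound.sum_log_div_mul_pred_le_two N

/-- **`∑_{n ≤ N} Λ(n)/n ≤ log N + log 4 + 2`** (Mertens I of the tree for the primes plus the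
prime powers). [folklore] -/
theorem sum_vonMangoldt_div_le (N : ℕ) :
    ∑ n ∈ Icc 1 N, Λ n / n ≤ Real.log N + Real.log 4 + 2 := by
  classical
  rw [← sum_filter_add_sum_filter_not (Icc 1 N) Nat.Prime]
  have hprimes : ∑ n ∈ (Icc 1 N).filter Nat.Prime, Λ n / n = ∑ p ∈ Nat.primesLE N, Real.log p / p := by
    have hset : (Icc 1 N).filter Nat.Prime = Nat.primesLE N := by
      ext p
      rw [mem_filter, mem_Icc, Nat.mem_primesLE]
      constructor
      · rintro ⟨⟨-, h2⟩, hp⟩; exact ⟨h2, hp⟩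
      · rintro ⟨h2, hp⟩; exact ⟨⟨hp.one_le, h2⟩, hp⟩
    rw [hset]
    refine sum_congr rfl fun p hp => ?_
    rw [Nat.mem_primesLE] at hp
    rw [ArithmeticFunction.vonMangoldt_apply_prime hp.2]
  rw [hprimes]
  have h1 := Literature.NumberTheory.LFunctions.MertensBound.sum_log_div_prime_le N
  have h2 := sum_vonMangoldt_div_not_prime_le N
  linarith

/-- **Tail of `∑ Λ(n) n^{-1-δ}` beyond `Y`:** for `0 < δ ≤ 1` and naturals `2 ≤ Y ≤ M`,
`∑_{Y < n ≤ M} Λ(n) n^{-(1+δ)} ≤ (3 log 4/δ + 2) Y^{-δ}` (the primes by partial summation against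
Chebyshev's `ϑ`, the prime powers by `∑_p log p/(p(p-1)) ≤ 2` and `n^{-δ} ≤ Y^{-δ}`). [folklore] -/
theorem sum_Ioc_vonMangoldt_mul_rpow_le {d : ℝ} (hd : 0 < d) (hd1 : d ≤ 1) {Y M : ℕ} (hY : 2 ≤ Y)
    (hYM : Y ≤ M) :
    ∑ n ∈ Ioc Y M, Λ n * (n : ℝ) ^ (-(1 + d)) ≤ (3 * Real.log 4 / d + 2) * (Y : ℝ) ^ (-d) := by
  classical
  have hY0 : (0 : ℝ) < Y := by positivity
  rw [← sum_filter_add_sum_filter_not (Ioc Y M) Nat.Prime]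
  -- primes
  have hpr : ∑ n ∈ (Ioc Y M).filter Nat.Prime, Λ n * (n : ℝ) ^ (-(1 + d)) ≤
      3 * Real.log 4 / d * (Y : ℝ) ^ (-d) := by
    have h := Literature.NumberTheory.LFunctions.sum_Ioc_prime_log_mul_rpow_le
      (σ := 1 + d) (by linarith) (by linarith) hY hYM
    have heq : ∑ n ∈ (Ioc Y M).filter Nat.Prime, Λ n * (n : ℝ) ^ (-(1 + d)) =
        ∑ p ∈ (Ioc Y M).filter Nat.Prime, Real.log p * (p : ℝ) ^ (-(1 + d)) := by
      refine sum_congr rfl fun p hp => ?_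
      rw [mem_filter] at hp
      rw [ArithmeticFunction.vonMangoldt_apply_prime hp.2]
    rw [heq]
    refine h.trans (le_of_eq ?_)
    have : (1 : ℝ) - (1 + d) = -d := by ring
    rw [this, add_sub_cancel_left]
    ring
  -- prime powers
  have hpp : ∑ n ∈ (Ioc Y M).filter (fun n => ¬ n.Prime), Λ n * (n : ℝ) ^ (-(1 + d)) ≤
      2 * (Y : ℝ) ^ (-d) := by
    have hterm : ∀ n ∈ (Ioc Y M).filter (fun n => ¬ n.Prime),
        Λ n * (n : ℝ) ^ (-(1 + d)) ≤ (Y : ℝ) ^ (-d) * (Λ n / n) := by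
      intro n hn
      rw [mem_filter, mem_Ioc] at hn
      have hn0 : (0 : ℝ) < n := by exact_mod_cast (lt_of_le_of_lt (Nat.zero_le Y) hn.1.1)
      have hYn : (Y : ℝ) ≤ n := by exact_mod_cast hn.1.1.le
      rw [Real.rpow_neg hn0.le, Real.rpow_add hn0, Real.rpow_one, mul_inv, div_eq_mul_inv]
      have h1 : ((n : ℝ) ^ d)⁻¹ ≤ (Y : ℝ) ^ (-d) := by
        rw [Real.rpow_neg hY0.le]
        exact inv_anti₀ (Real.rpow_pos_of_pos hY0 d) (Real.rpow_le_rpow hY0.le hYn hd.le)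
      have hΛ : 0 ≤ Λ n := ArithmeticFunction.vonMangoldt_nonneg
      calc Λ n * ((n : ℝ)⁻¹ * ((n : ℝ) ^ d)⁻¹) = ((n : ℝ) ^ d)⁻¹ * (Λ n * (n : ℝ)⁻¹) := by ring
        _ ≤ (Y : ℝ) ^ (-d) * (Λ n * (n : ℝ)⁻¹) :=
            mul_le_mul_of_nonneg_right h1 (mul_nonneg hΛ (by positivity))
    refine (sum_le_sum hterm).trans ?_
    rw [← mul_sum, mul_comm]
    refine mul_le_mul_of_nonneg_right ?_ (by positivity)
    have hsub : (Ioc Y M).filter (fun n => ¬ n.Prime) ⊆ (Icc 1 M).filter (fun n => ¬ n.Prime) := by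
      intro n hn
      rw [mem_filter, mem_Ioc] at hn
      rw [mem_filter, mem_Icc]
      exact ⟨⟨by omega, hn.1.2⟩, hn.2⟩
    refine (sum_le_sum_of_subset_of_nonneg hsub fun n _ _ => ?_).trans
      (sum_vonMangoldt_div_not_prime_le M)
    exact div_nonneg ArithmeticFunction.vonMangoldt_nonneg (Nat.cast_nonneg n)
  calc _ ≤ 3 * Real.log 4 / d * (Y : ℝ) ^ (-d) + 2 * (Y : ℝ) ^ (-d) := add_le_add hpr hpp
    _ = _ := by ring

/-- A finite set of exponents `≥ e₀` has `∑ p^{-e} ≤ 2 p^{-e₀}` (`p ≥ 2`). [folklore] -/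
theorem sum_inv_pow_le_two_mul {p : ℕ} (hp : 2 ≤ p) (E : Finset ℕ) {e₀ : ℕ} (hE : ∀ e ∈ E, e₀ ≤ e) :
    ∑ e ∈ E, ((p : ℝ) ^ e)⁻¹ ≤ 2 * ((p : ℝ) ^ e₀)⁻¹ := by
  have hp0 : (0 : ℝ) < p := by positivity
  have hp2 : (2 : ℝ) ≤ p := by exact_mod_cast hp
  set x : ℝ := (p : ℝ)⁻¹ with hx
  have hx0 : 0 ≤ x := by positivity
  have hx1 : x ≤ 1 / 2 := by rw [hx, inv_le_comm₀ hp0 (by norm_num)]; linarith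
  have hterm : ∀ e, ((p : ℝ) ^ e)⁻¹ = x ^ e := fun e => by rw [hx, inv_pow]
  simp_rw [hterm]
  -- `E ⊆ Ico e₀ (M+1)` with `M = E.sup id`
  set M := E.sup id with hM
  have hsub : E ⊆ Ico e₀ (M + 1) := by
    intro e he
    rw [mem_Ico]
    exact ⟨hE e he, Nat.lt_succ_of_le (Finset.le_sup (f := id) he)⟩
  calc ∑ e ∈ E, x ^ e ≤ ∑ e ∈ Ico e₀ (M + 1), x ^ e :=
        sum_le_sum_of_subset_of_nonneg hsub fun e _ _ => by positivity
    _ ≤ x ^ e₀ / (1 - x) := geom_sum_Ico_le_of_lt_one hx0 (by linarith)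
    _ ≤ 2 * x ^ e₀ := by
        rw [div_le_iff₀ (by linarith)]
        have : 0 ≤ x ^ e₀ := by positivity
        nlinarith

/-- **Prime powers of small primes in a range beyond `X`:** for naturals `z`, `Y` and `1 ≤ X`,
`∑_{X < n ≤ Y, n = p^a, p ≤ z} Λ(n)/n ≤ 2 ϑ(z)/X ≤ 2 log 4 · z / X`
(for each `p`, `∑_{a : p^a > X} p^{-a} < 2/X`). [folklore] -/
theorem sum_vonMangoldt_div_smallPrime_le (z : ℕ) {X : ℕ} (hX : 1 ≤ X) (Y : ℕ) :
    ∑ n ∈ (Ioc X Y).filter (fun n => IsPrimePow n ∧ n.minFac ≤ z), Λ n / n ≤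
      2 * (Real.log 4 * z) / X := by
  classical
  have hX0 : (0 : ℝ) < X := by exact_mod_cast hX
  set S := (Ioc X Y).filter (fun n => IsPrimePow n ∧ n.minFac ≤ z) with hS
  have hfib : ∀ n ∈ S, n.minFac ∈ Nat.primesLE z := by
    intro n hn
    rw [hS, mem_filter, mem_Ioc] at hn
    rw [Nat.mem_primesLE]
    exact ⟨hn.2.2, Nat.minFac_prime (by have := hn.2.1.one_lt; omega)⟩
  rw [← Finset.sum_fiberwise_of_maps_to hfib]
  have hinner : ∀ p ∈ Nat.primesLE z, ∑ n ∈ S.filter (fun n => n.minFac = p), Λ n / n ≤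
      Real.log p * (2 / X) := by
    intro p hp
    rw [Nat.mem_primesLE] at hp
    have hpr := hp.2
    have hp1 : 1 < p := hpr.one_lt
    set F := S.filter (fun n => n.minFac = p) with hF
    -- structure of the fibre
    have hFprop : ∀ n ∈ F, n = p ^ (Nat.log p n) ∧ X < n := by
      intro n hn
      rw [hF, mem_filter, hS, mem_filter, mem_Ioc] at hn
      obtain ⟨⟨⟨hXn, -⟩, hpp, -⟩, hmin⟩ := hn
      refine ⟨?_, hXn⟩
      obtain ⟨q, k, hq, hk, rfl⟩ := hpp
      have hq' : q.Prime := Nat.prime_iff.2 hq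
      have hqp : q = p := by rw [← hmin, Nat.Prime.pow_minFac hq' hk.ne']
      subst hqp
      rw [Nat.log_pow hp1]
    have hval : ∀ n ∈ F, Λ n / n = Real.log p * ((p : ℝ) ^ (Nat.log p n))⁻¹ := by
      intro n hn
      obtain ⟨hn1, -⟩ := hFprop n hn
      have hΛ : Λ n = Real.log p := by
        conv_lhs => rw [hn1]
        rw [ArithmeticFunction.vonMangoldt_apply_pow, ArithmeticFunction.vonMangoldt_apply_prime hpr]
        intro h0
        rw [h0, pow_zero] at hn1
        have := (hFprop n hn).2
        omega
      rw [hΛ, div_eq_mul_inv]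
      congr 1
      conv_lhs => rw [hn1]
      push_cast
      rfl
    have hinj : Set.InjOn (fun n => Nat.log p n) F := by
      intro n hn n' hn' h
      rw [(hFprop n hn).1, (hFprop n' hn').1]
      simp only at h
      rw [h]
    have hexp : ∀ e ∈ F.image (fun n => Nat.log p n), Nat.log p X + 1 ≤ e := by
      intro e he
      rw [mem_image] at he
      obtain ⟨n, hn, rfl⟩ := he
      obtain ⟨hn1, hXn⟩ := hFprop n hn
      have : X < p ^ Nat.log p n := by rw [← hn1]; exact hXn
      exact Nat.succ_le_of_lt (Nat.log_lt_of_lt_pow (by omega) this)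
    rw [sum_congr rfl hval, ← mul_sum]
    refine mul_le_mul_of_nonneg_left ?_ (Real.log_natCast_nonneg p)
    rw [← sum_image (g := fun n => Nat.log p n) (f := fun e => ((p : ℝ) ^ e)⁻¹) hinj]
    refine (sum_inv_pow_le_two_mul hpr.two_le _ hexp).trans ?_
    -- `2 p^{-(log_p X + 1)} ≤ 2 / X`
    rw [div_eq_mul_inv]
    refine mul_le_mul_of_nonneg_left ?_ (by norm_num)
    have hlt : X < p ^ (Nat.log p X + 1) := Nat.lt_pow_succ_log_self hp1 X
    have hlt' : (X : ℝ) < (p : ℝ) ^ (Nat.log p X + 1) := by exact_mod_cast hlt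
    exact inv_anti₀ hX0 hlt'.le
  refine (sum_le_sum hinner).trans ?_
  rw [← sum_mul]
  have hθ : ∑ p ∈ Nat.primesLE z, Real.log p ≤ Real.log 4 * z := by
    have h := Chebyshev.theta_le_log4_mul_x (x := (z : ℝ)) (Nat.cast_nonneg z)
    rwa [Chebyshev.theta_eq_sum_primesLE, Nat.floor_natCast] at h
  calc (∑ p ∈ Nat.primesLE z, Real.log p) * (2 / X) ≤ (Real.log 4 * z) * (2 / X) :=
        mul_le_mul_of_nonneg_right hθ (by positivity)
    _ = 2 * (Real.log 4 * z) / X := by ring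

end Literature.NumberTheory.LFunctions.LogFreeDensity
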